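import Literature.NumberTheory.Weil1964.AdelicMetaplecticTensorSchur
import Literature.NumberTheory.Weil1964.AdelicMetaplecticFinRep
import Literature.Analysis.SegalBargmann.SchwartzTensorStripping
import Literature.LinearAlgebra.TensorProductCommutant
import HarnessLib

/-!
# Sum-stripping: an implementer of `g₁ ⊕ 1` on `𝒮(𝔸^{ι₁ ⊕ ι₂})` IS `M₁ ⊠ 1` with `(g₁, M₁) ∈ Mp_ψ(W₁)ᶜᵒⁿᵗ`

Topic `NumberTheory/Weil1964`; namespace `Literature.NumberTheory.Weil1964`. KERNEL MATHEMATICS ONLY: every declaration is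
proved; no `def … : Prop` record, no `axiom`, no cited hypothesis. A REPRODUCTION of the «produce» direction of Weil's
functoriality of the metaplectic group for orthogonal direct sums (Literature side).

Setting: a number field `F`, index types `ι₁, ι₂`, invertible adelic Gram matrices `T₁, T₂`, `T = T₁ ⊕ T₂` on
`ι₁ ⊕ ι₂`, the global Schrödinger representations `ρ_j`, `ρ` on `𝒮(𝔸_F^{ι_j})`, `𝒮(𝔸_F^{ι₁ ⊕ ι₂})`, Weil's groups
`Mp_ψ(W)ᶜᵒⁿᵗ = adelicMpCont` of LF-continuous implementing pairs `(g, M)`, the see-saw embedding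
`spSum T₁ T₂ (g₁, g₂) = g₁ ⊕ g₂` and the separate-variables product `Φ₁ ⊠ Φ₂ = tensorToSum F ι₁ ι₂ Φ₁ Φ₂`.

**Main theorem** (`exists_strip_of_fst_eq_spSum_one`): if `(G, M) ∈ Mp_ψ(W₁ ⊕ W₂)ᶜᵒⁿᵗ` lies over `G = g₁ ⊕ 1`, then
there is `(g₁, M₁) ∈ Mp_ψ(W₁)ᶜᵒⁿᵗ` with `M (Φ₁ ⊠ Φ₂) = M₁ Φ₁ ⊠ Φ₂` for ALL `Φ₁, Φ₂`; `M₁` is unique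
(`strip_unique`). This is the direction of [MoeglinVignerasWaldspurger1987, Chap. 2 II.1 Rem. (6)] /
[Weil1964, Chap. III n° 37–38] that PRODUCES the implementer on the first summand — the tree's two-factor Schur lemma
`exists_ne_zero_smul_tensorToSum_of_fst_eq_spSum` only COMPARES with given implementers. Consequence: any continuous
homomorphism into `Mp_ψ(W₁ ⊕ W₂)ᶜᵒⁿᵗ` over `g ↦ ι(g) ⊕ 1` strips to one into `Mp_ψ(W₁)ᶜᵒⁿᵗ` over `ι` (the «undoubling»
step of the doubling construction of [GelbartRogawski1991, Prop. 3.1.1]; sequel file).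

Route (all inputs are landed tree theorems):
* `M = A ⊗ M_f` by tensor stripping (`exists_finImplementer`, `exists_continuousLinearEquiv_of_mem_adelicMpCont`);
* FINITE factor (§1): `M_f` commutes with `1 ⊠ ρ_{f,2}(h₂)` for the finite Heisenberg elements `h₂` of `W₂`
  (`act_spSum_inrH`, `finOp_inrH`), whose commutant in `End 𝒮((𝔸_F^∞)^{ι₂})` is scalar
  (`FiniteAdeleSchrodingerIrreducible.eq_smul_id_of_comm`); hence `M_f = B₁ ⊠ 1` by the algebraic tensor commutant
  lemma `LinearAlgebra.exists_tmul_eq_of_commute_lTensor`;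
* ARCHIMEDEAN factor (§2): by `arch_covariant_rhoSD_of_implements` at the pairs `(0 ⊔ a₂, 0 ⊔ w₂)` (Weil's phase and
  Folland's cocycle are `1` there, the phase-space map is the identity on the second block) `A` commutes with the
  second-block Heisenberg operators `ρ_D(0 ⊔ p₂, 0 ⊔ q₂)`, hence `A (φ₁ ⊠ φ₂) = A₁ φ₁ ⊠ φ₂` by the Schwartz-space
  stripping theorem `SegalBargmann.exists_strip_piBoxTensor_of_commute_rhoSD_inr`;
* assembly (§3) by the pure-tensor packaging of `AdelicSchwartzBruhatDirectSumPure` with both scalars `1`; the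
  stripped operator `M₁ = A₁ ⊗ B₁` implements `g₁` on ALL of `H(W₁)(𝔸)` by `⊠ Φ₂`-cancellation against
  `ρ(inlH h₁)(Φ₁ ⊠ Φ₂) = ρ₁(h₁)Φ₁ ⊠ Φ₂`, and is LF-continuous with its inverse (the same for `(G, M)⁻¹`).

## References
* [Weil1964] A. Weil, *Sur certains groupes d'opérateurs unitaires*, Acta Math. 111 (1964), Chap. III n° 37–38
  pp. 188–190 (restricted products; restriction of `𝐫` to a direct-sum decomposition).
* [MoeglinVignerasWaldspurger1987] C. Mœglin, M.-F. Vignéras, J.-L. Waldspurger, *Correspondances de Howe sur un corps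
  p-adique*, LNM 1291 (1987), Chap. 2 II.1 Rem. (6).
* [Kudla1984] S. Kudla, *Seesaw dual reductive pairs*, Progr. Math. 46 (1984), §1.
* [GelbartRogawski1991] S. Gelbart, J. Rogawski, Invent. Math. 105 (1991), §3.1 Prop. 3.1.1 — the application.

## Provenance

LEAN-IN-TREE rule (2026-08-18), pub-hodgecm model-construction sub-cell, seat own-crow gen 2 (third hand on GR-2's
[GelbartRogawski1991, Prop. 3.1.1] construction `GRSkeleton`, stub S4 «undoubling»).
-/

set_option autoImplicit false

noncomputable section

open scoped Matrix SchwartzMap TensorProduct Classical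

open NumberField NumberField.mixedEmbedding IsDedekindDomain

namespace Literature.NumberTheory.Weil1964

open Literature.NumberTheory.Automorphic Literature.RepresentationTheory.HeisenbergGroup
open Literature.Analysis.SegalBargmann (rhoSD piBoxTensor sumCarrierEquiv piCarrierEquiv
  exists_strip_piBoxTensor_of_commute_rhoSD_inr)

variable {F : Type} [Field F] [NumberField F]

/-! ### §1 The finite factor: `M_f = B₁ ⊠ 1` -/

section Finite

variable {ι₁ ι₂ : Type} [Fintype ι₁] [Fintype ι₂] [DecidableEq ι₁] [DecidableEq ι₂]
variable {T₁ : Matrix ι₁ ι₁ (AdeleRing (𝓞 F) F)} {T₂ : Matrix ι₂ ι₂ (AdeleRing (𝓞 F) F)}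

/-- **Schur for the finite Schrödinger operators of the finite Heisenberg elements**: for `y ↦ T₂ y` onto, an
endomorphism of `𝒮((𝔸_F^∞)^{ι₂})` commuting with every `ρ_f(h₂)`, `h₂ ∈ finHeisenberg T₂`, is a scalar (the finite
translations and modulations are among these operators; `eq_smul_id_of_comm`).
[cite: MoeglinVignerasWaldspurger1987, Chap. 2 I.3, II.2] -/
theorem exists_eq_smul_id_of_comm_finSchrodinger
    (hT₂ : Function.Surjective fun y : ι₂ → AdeleRing (𝓞 F) F => T₂ *ᵥ y) (C : FinSB F ι₂ →ₗ[ℂ] FinSB F ι₂)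
    (hC : ∀ h ∈ finHeisenberg T₂, C ∘ₗ finSchrodinger T₂ h = finSchrodinger T₂ h ∘ₗ C) :
    ∃ c : ℂ, C = c • LinearMap.id := by
  refine eq_smul_id_of_comm C (fun k f => ?_) (fun y f => ?_)
  · have hmem : Heisenberg.ofVec (polar (adelicForm F ι₂ T₂)) (piAdeleSplit F ι₂ (0, k), 0) ∈ finHeisenberg T₂ :=
      ofVec_mem_finHeisenberg (finIdem_smul_piAdeleSplit_zero k) (smul_zero _)
    have h := LinearMap.congr_fun (hC _ hmem) f
    rw [finSchrodinger_ofVec_inl] at h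
    exact h
  · obtain ⟨y', hy', hTy'⟩ := exists_fin_mulVec_eq hT₂ y
    have hmem : Heisenberg.ofVec (polar (adelicForm F ι₂ T₂)) (0, y') ∈ finHeisenberg T₂ :=
      ofVec_mem_finHeisenberg (smul_zero _) hy'
    have h := LinearMap.congr_fun (hC _ hmem) f
    rw [finSchrodinger_ofVec_inr T₂ hTy'] at h
    exact h

/-- `ρ_f(inrH h₂) = 1 ⊠ ρ_{f,2}(h₂)` on `𝒮((𝔸_F^∞)^{ι₁ ⊕ ι₂})`. [cite: Weil1964, Chap. III n° 38 p. 190] -/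
theorem finSchrodinger_inrH (h₂ : AdelicHeisenberg F ι₂ T₂) :
    finSchrodinger (Matrix.fromBlocks T₁ 0 0 T₂) (inrH T₁ T₂ h₂) = finSumEnd LinearMap.id (finSchrodinger T₂ h₂) := by
  rw [finSchrodinger_def, finSchrodinger_def, finOp_inrH, inrH_t, finSumEnd_smul_right]

/-- `ρ_f(inlH h₁) = ρ_{f,1}(h₁) ⊠ 1` on `𝒮((𝔸_F^∞)^{ι₁ ⊕ ι₂})`. [cite: Weil1964, Chap. III n° 38 p. 190] -/
theorem finSchrodinger_inlH (h₁ : AdelicHeisenberg F ι₁ T₁) :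
    finSchrodinger (Matrix.fromBlocks T₁ 0 0 T₂) (inlH T₁ T₂ h₁) = finSumEnd (finSchrodinger T₁ h₁) LinearMap.id := by
  rw [finSchrodinger_def, finSchrodinger_def, finOp_inlH, inlH_t, finSumEnd_smul_left]

/-- **A finite implementer of `g₁ ⊕ 1` commutes with `1 ⊠ ρ_{f,2}(h₂)`** for every finite Heisenberg element `h₂` of
`W₂` (`(g₁ ⊕ 1) · inrH h₂ = inrH h₂`). [cite: Weil1964, Chap. III n° 37–38 pp. 188–190] -/
theorem finImplementer_comp_finSumEnd_inr {g₁ : symplecticGroup (polar (adelicForm F ι₁ T₁))}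
    {Mf : FinSB F (ι₁ ⊕ ι₂) ≃ₗ[ℂ] FinSB F (ι₁ ⊕ ι₂)}
    (hMf : ∀ h ∈ finHeisenberg (Matrix.fromBlocks T₁ 0 0 T₂), ∀ Φ : piSchwartzBruhat F (ι₁ ⊕ ι₂),
      adelicTensorEnd LinearMap.id (Mf : FinSB F (ι₁ ⊕ ι₂) →ₗ[ℂ] FinSB F (ι₁ ⊕ ι₂))
          (adelicSchrodinger F (ι₁ ⊕ ι₂) (Matrix.fromBlocks T₁ 0 0 T₂) h Φ) =
        adelicSchrodinger F (ι₁ ⊕ ι₂) (Matrix.fromBlocks T₁ 0 0 T₂)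
          ((ofSymplectic (polar (adelicForm F (ι₁ ⊕ ι₂) (Matrix.fromBlocks T₁ 0 0 T₂)))
            (UnitaryGroup.spSum T₁ T₂ (g₁, 1))).act h)
          (adelicTensorEnd LinearMap.id (Mf : FinSB F (ι₁ ⊕ ι₂) →ₗ[ℂ] FinSB F (ι₁ ⊕ ι₂)) Φ))
    {h₂ : AdelicHeisenberg F ι₂ T₂} (hh₂ : h₂ ∈ finHeisenberg T₂) :
    (Mf : FinSB F (ι₁ ⊕ ι₂) →ₗ[ℂ] FinSB F (ι₁ ⊕ ι₂)) ∘ₗ finSumEnd LinearMap.id (finSchrodinger T₂ h₂) =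
      finSumEnd LinearMap.id (finSchrodinger T₂ h₂) ∘ₗ (Mf : FinSB F (ι₁ ⊕ ι₂) →ₗ[ℂ] FinSB F (ι₁ ⊕ ι₂)) := by
  have hact : (ofSymplectic (polar (adelicForm F (ι₁ ⊕ ι₂) (Matrix.fromBlocks T₁ 0 0 T₂)))
      (UnitaryGroup.spSum T₁ T₂ (g₁, 1))).act (inrH T₁ T₂ h₂) = inrH T₁ T₂ h₂ := by
    rw [act_spSum_inrH, map_one, Heisenberg.PseudoSymplectic.act_one]
  have H : adelicTensorEnd LinearMap.id (Mf : FinSB F (ι₁ ⊕ ι₂) →ₗ[ℂ] FinSB F (ι₁ ⊕ ι₂)) ∘ₗ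
      adelicSchrodinger F (ι₁ ⊕ ι₂) (Matrix.fromBlocks T₁ 0 0 T₂) (inrH T₁ T₂ h₂) =
        adelicSchrodinger F (ι₁ ⊕ ι₂) (Matrix.fromBlocks T₁ 0 0 T₂) (inrH T₁ T₂ h₂) ∘ₗ
          adelicTensorEnd LinearMap.id (Mf : FinSB F (ι₁ ⊕ ι₂) →ₗ[ℂ] FinSB F (ι₁ ⊕ ι₂)) :=
    LinearMap.ext fun Φ => by
      rw [LinearMap.comp_apply, LinearMap.comp_apply, hMf _ (inrH_mem_finHeisenberg hh₂), hact]
  rw [adelicSchrodinger_eq_adelicTensorEnd_finSchrodinger (inrH_mem_finHeisenberg hh₂), finSchrodinger_inrH,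
    ← adelicTensorEnd_comp, ← adelicTensorEnd_comp, LinearMap.id_comp] at H
  exact adelicTensorEnd_id_left_injective H

/-- **FINITE SUM-STRIPPING.** A finite implementer `M_f` of `g₁ ⊕ 1` is `B₁ ⊠ 1` on products:
`M_f (f₁ ⊠_f f₂) = B₁ f₁ ⊠_f f₂` for a linear `B₁` of `𝒮((𝔸_F^∞)^{ι₁})` (for `y ↦ T₂ y` onto).
[cite: MoeglinVignerasWaldspurger1987, Chap. 2 II.1 Rem. (6); Weil1964, Chap. III n° 37–38 pp. 188–190] -/
theorem exists_finStrip (hT₂ : Function.Surjective fun y : ι₂ → AdeleRing (𝓞 F) F => T₂ *ᵥ y)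
    {g₁ : symplecticGroup (polar (adelicForm F ι₁ T₁))} {Mf : FinSB F (ι₁ ⊕ ι₂) ≃ₗ[ℂ] FinSB F (ι₁ ⊕ ι₂)}
    (hMf : ∀ h ∈ finHeisenberg (Matrix.fromBlocks T₁ 0 0 T₂), ∀ Φ : piSchwartzBruhat F (ι₁ ⊕ ι₂),
      adelicTensorEnd LinearMap.id (Mf : FinSB F (ι₁ ⊕ ι₂) →ₗ[ℂ] FinSB F (ι₁ ⊕ ι₂))
          (adelicSchrodinger F (ι₁ ⊕ ι₂) (Matrix.fromBlocks T₁ 0 0 T₂) h Φ) =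
        adelicSchrodinger F (ι₁ ⊕ ι₂) (Matrix.fromBlocks T₁ 0 0 T₂)
          ((ofSymplectic (polar (adelicForm F (ι₁ ⊕ ι₂) (Matrix.fromBlocks T₁ 0 0 T₂)))
            (UnitaryGroup.spSum T₁ T₂ (g₁, 1))).act h)
          (adelicTensorEnd LinearMap.id (Mf : FinSB F (ι₁ ⊕ ι₂) →ₗ[ℂ] FinSB F (ι₁ ⊕ ι₂)) Φ)) :
    ∃ B₁ : FinSB F ι₁ →ₗ[ℂ] FinSB F ι₁, ∀ (f₁ : FinSB F ι₁) (f₂ : FinSB F ι₂),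
      Mf (finSumEquiv F ι₁ ι₂ (f₁ ⊗ₜ f₂)) = finSumEquiv F ι₁ ι₂ (B₁ f₁ ⊗ₜ f₂) := by
  -- the operator read on the algebraic tensor product `𝒮_f(X₁) ⊗ 𝒮_f(X₂)`
  set T' : FinSB F ι₁ ⊗[ℂ] FinSB F ι₂ →ₗ[ℂ] FinSB F ι₁ ⊗[ℂ] FinSB F ι₂ :=
    (finSumEquiv F ι₁ ι₂).symm.toLinearMap ∘ₗ (Mf : FinSB F (ι₁ ⊕ ι₂) →ₗ[ℂ] FinSB F (ι₁ ⊕ ι₂)) ∘ₗ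
      (finSumEquiv F ι₁ ι₂).toLinearMap with hT'
  have hT'app : ∀ z, T' z = (finSumEquiv F ι₁ ι₂).symm (Mf (finSumEquiv F ι₁ ι₂ z)) := fun z => rfl
  -- it commutes with `id ⊗ ρ_{f,2}(h₂)` for the finite `h₂`
  have hcomm : ∀ s ∈ (fun h₂ => finSchrodinger T₂ h₂) '' finHeisenberg T₂,
      T' ∘ₗ LinearMap.lTensor (FinSB F ι₁) s = LinearMap.lTensor (FinSB F ι₁) s ∘ₗ T' := by
    rintro _ ⟨h₂, hh₂, rfl⟩
    have h := finImplementer_comp_finSumEnd_inr hMf hh₂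
    apply LinearMap.ext
    intro z
    have hz := LinearMap.congr_fun h (finSumEquiv F ι₁ ι₂ z)
    simp only [finSumEnd, LinearMap.comp_apply, LinearEquiv.coe_coe, LinearEquiv.symm_apply_apply] at hz
    show (finSumEquiv F ι₁ ι₂).symm (Mf (finSumEquiv F ι₁ ι₂ (TensorProduct.map LinearMap.id (finSchrodinger T₂ h₂) z))) =
      TensorProduct.map LinearMap.id (finSchrodinger T₂ h₂) ((finSumEquiv F ι₁ ι₂).symm (Mf (finSumEquiv F ι₁ ι₂ z)))
    rw [hz, LinearEquiv.symm_apply_apply]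
  -- Schur for the second factor, then the algebraic tensor commutant lemma
  have hS : ∀ f : FinSB F ι₂ →ₗ[ℂ] FinSB F ι₂,
      (∀ s ∈ (fun h₂ => finSchrodinger T₂ h₂) '' finHeisenberg T₂, f ∘ₗ s = s ∘ₗ f) → ∃ c : ℂ, f = c • LinearMap.id :=
    fun f hf => exists_eq_smul_id_of_comm_finSchrodinger hT₂ f fun h₂ hh₂ => hf _ ⟨h₂, hh₂, rfl⟩
  obtain ⟨B₁, hB₁⟩ := Literature.LinearAlgebra.exists_tmul_eq_of_commute_lTensor hS T' hcomm
  refine ⟨B₁, fun f₁ f₂ => ?_⟩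
  have h := hB₁ f₁ f₂
  rw [hT'app, LinearEquiv.symm_apply_eq] at h
  exact h

end Finite

/-! ### §2 The archimedean factor: `A (φ₁ ⊠ φ₂) = A₁ φ₁ ⊠ φ₂` -/

section Arch

variable {ι : Type} [Fintype ι] [DecidableEq ι] (T : Matrix ι ι (AdeleRing (𝓞 F) F))

omit [Fintype ι] [DecidableEq ι] in
/-- `archVec 0 = 0`. [folklore] -/
private theorem archVec_zero : archVec F ι (0 : ι → mixedSpace F) = 0 := by
  rw [archVec, Prod.mk_zero_zero, map_zero]

omit [Fintype ι] [DecidableEq ι] in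
/-- `piArch 0 = 0`. [folklore] -/
private theorem piArch_zero' : piArch F ι (0 : ι → AdeleRing (𝓞 F) F) = 0 := by
  rw [← archVec_zero, piArch_archVec]

/-- The archimedean phase-space action fixes the origin. [folklore] -/
private theorem archAct_zero (g : symplecticGroup (polar (adelicForm F ι T))) :
    archAct T g ((0 : ι → mixedSpace F), (0 : ι → mixedSpace F)) = (0, 0) := by
  simp only [archAct, archVec_zero, Prod.mk_zero_zero, map_zero, Prod.fst_zero, Prod.snd_zero, piArch_zero']

/-- Weil's cocycle phase at the origin is `1` (`f_g(0) = 0`). [cite: Weil1964, n° 5, pp. 150–151] -/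
private theorem weilPhase_zero (g : symplecticGroup (polar (adelicForm F ι T))) :
    weilPhase T g ((0 : ι → mixedSpace F), (0 : ι → mixedSpace F)) = 1 := by
  have hf : (ofSymplectic (polar (adelicForm F ι T)) g).f (archVec F ι 0, archVec F ι 0) = 0 := by
    rw [ofSymplectic_f, archVec_zero, Prod.mk_zero_zero, map_zero, map_zero]
    simp
  simp only [weilPhase, hf, AddChar.map_zero_eq_one, Circle.coe_one]

/-- The Folland cocycle at the origin is `1`. [folklore] -/
private theorem follandCocycle_zero {σ : Type*} [Fintype σ] (e : (ι → mixedSpace F) ≃L[ℝ] (σ → ℝ))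
    (g : symplecticGroup (polar (adelicForm F ι T))) :
    follandCocycle T e g ((0 : ι → mixedSpace F), (0 : ι → mixedSpace F)) = 1 := by
  rw [follandCocycle, weilPhase_zero, archAct_zero]
  simp only [map_zero, zero_dotProduct, mul_zero, Complex.ofReal_zero, zero_mul, neg_zero, Complex.exp_zero,
    mul_one]

omit [DecidableEq ι] in
/-- `follandFreq e 0 = 0`. [folklore] -/
private theorem follandFreq_zero {σ : Type*} (e : (ι → mixedSpace F) ≃L[ℝ] (σ → ℝ)) :
    follandFreq F ι e (0 : ι → mixedSpace F) = 0 := by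
  rw [← follandFreqₗ_apply, map_zero]

variable {ι₁ ι₂ : Type} [Fintype ι₁] [Fintype ι₂] [DecidableEq ι₁] [DecidableEq ι₂]
variable {τ : Type*} [Fintype τ] (b : Module.Basis τ ℝ (mixedSpace F))
variable (T₁ : Matrix ι₁ ι₁ (AdeleRing (𝓞 F) F)) (T₂ : Matrix ι₂ ι₂ (AdeleRing (𝓞 F) F))
  (hT₁ : IsUnit (archMat F ι₁ T₁)) (hT₂ : IsUnit (archMat F ι₂ T₂))
variable (G : symplecticGroup (polar (adelicForm F (ι₁ ⊕ ι₂) (Matrix.fromBlocks T₁ 0 0 T₂))))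
  (g₁ : symplecticGroup (polar (adelicForm F ι₁ T₁)))
  (hg : ∀ (x₁ y₁ : ι₁ → AdeleRing (𝓞 F) F) (x₂ y₂ : ι₂ → AdeleRing (𝓞 F) F),
    G.1 (Sum.elim x₁ x₂, Sum.elim y₁ y₂) =
      (Sum.elim (g₁.1 (x₁, y₁)).1 ((1 : symplecticGroup (polar (adelicForm F ι₂ T₂))).1 (x₂, y₂)).1,
        Sum.elim (g₁.1 (x₁, y₁)).2 ((1 : symplecticGroup (polar (adelicForm F ι₂ T₂))).1 (x₂, y₂)).2))
variable (M : piSchwartzBruhat F (ι₁ ⊕ ι₂) ≃ₗ[ℂ] piSchwartzBruhat F (ι₁ ⊕ ι₂))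
  (hM : Implements (adelicSchrodinger F (ι₁ ⊕ ι₂) (Matrix.fromBlocks T₁ 0 0 T₂))
    (ofSymplectic (polar (adelicForm F (ι₁ ⊕ ι₂) (Matrix.fromBlocks T₁ 0 0 T₂))) G) M)
  (A : 𝓢((ι₁ ⊕ ι₂ → mixedSpace F), ℂ) →ₗ[ℂ] 𝓢((ι₁ ⊕ ι₂ → mixedSpace F), ℂ))
  (Mf : FinSB F (ι₁ ⊕ ι₂) →ₗ[ℂ] FinSB F (ι₁ ⊕ ι₂))
  (hAM : ∀ (Φ : 𝓢((ι₁ ⊕ ι₂ → mixedSpace F), ℂ)) (f : FinSB F (ι₁ ⊕ ι₂)),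
    M (piSchwartzBruhatEquiv F (ι₁ ⊕ ι₂) (Φ ⊗ₜ f)) = piSchwartzBruhatEquiv F (ι₁ ⊕ ι₂) (A Φ ⊗ₜ Mf f))
  {f₀ : FinSB F (ι₁ ⊕ ι₂)} (hf₀ : Mf f₀ ≠ 0)

include hT₂ hg hM hAM hf₀ in
/-- **The archimedean factor of an implementer of `g₁ ⊕ 1` commutes with the second-block Heisenberg operators**
`ρ_D(0 ⊔ p₂, 0 ⊔ q₂)` (`ρ_D = rhoSD (sumCarrierEquiv b ι₁ ι₂)`): Weil's phase and Folland's cocycle are `1` on the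
pairs `(0 ⊔ a₂, 0 ⊔ w₂)` and the phase-space map fixes them. [cite: Folland1989, Prop. (1.43); Weil1964, n° 5, pp. 150–151] -/
theorem arch_comm_rhoSD_inr (p₂ q₂ : ι₂ × τ → ℝ) (Φ : 𝓢((ι₁ ⊕ ι₂ → mixedSpace F), ℂ)) :
    A (rhoSD (sumCarrierEquiv b ι₁ ι₂) (Sum.elim (0 : ι₁ × τ → ℝ) p₂) (Sum.elim (0 : ι₁ × τ → ℝ) q₂) Φ) =
      rhoSD (sumCarrierEquiv b ι₁ ι₂) (Sum.elim (0 : ι₁ × τ → ℝ) p₂) (Sum.elim (0 : ι₁ × τ → ℝ) q₂) (A Φ) := by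
  obtain ⟨⟨a₂, w₂⟩, haw⟩ := (archFolland_bijective T₂ (piCarrierEquiv b ι₂) hT₂).2 (p₂, q₂)
  have hp : piCarrierEquiv b ι₂ a₂ = p₂ := congrArg Prod.fst haw
  have hq : follandFreq F ι₂ (piCarrierEquiv b ι₂) (archMat F ι₂ T₂ *ᵥ w₂) = q₂ := congrArg Prod.snd haw
  have key := arch_covariant_rhoSD_of_implements (Matrix.fromBlocks T₁ 0 0 T₂) (sumCarrierEquiv b ι₁ ι₂) G M hM A
    Mf hAM hf₀ (Sum.elim 0 a₂) (Sum.elim 0 w₂) Φ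
  have h1 : archAct T₂ (1 : symplecticGroup (polar (adelicForm F ι₂ T₂))) (a₂, w₂) = (a₂, w₂) :=
    archAct_eq_self_of_apply_archVec 1 (fun _ _ => rfl) _
  rw [follandCocycle_sumElim b T₁ T₂ G g₁ 1 hg, archAct_sumElim T₁ T₂ G g₁ 1 hg, follandCocycle_zero, archAct_zero, h1,
    follandCocycle_eq_one_of_apply_archVec _ 1 (fun _ _ => rfl), one_mul, one_smul] at key
  simp only [sumCarrierEquiv_sumElim, archMat_fromBlocks, fromBlocks_diag_mulVec_sumElim, follandFreq_sumElim,
    Matrix.mulVec_zero, map_zero, follandFreq_zero, hp, hq] at key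
  exact key

include b hT₂ hg hM hAM hf₀ in
/-- **ARCHIMEDEAN SUM-STRIPPING**: the archimedean factor `A` (a topological automorphism) of an implementer of
`g₁ ⊕ 1` acts on separate-variable products through the first factor, `A (φ₁ ⊠_∞ φ₂) = A₁ φ₁ ⊠_∞ φ₂` for a continuous
linear `A₁` of `𝓢((F ⊗ ℝ)^{ι₁})`. [cite: Folland1989, Prop. (1.43); MoeglinVignerasWaldspurger1987, Chap. 2 II.1 Rem. (6)] -/
theorem exists_archStrip (hAc : Continuous A) :
    ∃ A₁ : 𝓢((ι₁ → mixedSpace F), ℂ) →L[ℂ] 𝓢((ι₁ → mixedSpace F), ℂ),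
      ∀ (φ₁ : 𝓢((ι₁ → mixedSpace F), ℂ)) (φ₂ : 𝓢((ι₂ → mixedSpace F), ℂ)),
        A (archBoxTensor φ₁ φ₂) = archBoxTensor (A₁ φ₁) φ₂ := by
  obtain ⟨A₁, h⟩ := exists_strip_piBoxTensor_of_commute_rhoSD_inr b (⟨A, hAc⟩ : 𝓢((ι₁ ⊕ ι₂ → mixedSpace F), ℂ) →L[ℂ]
    𝓢((ι₁ ⊕ ι₂ → mixedSpace F), ℂ)) (fun p₂ q₂ Φ => arch_comm_rhoSD_inr b T₁ T₂ hT₂ G g₁ hg M hM A Mf hAM hf₀ p₂ q₂ Φ)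
  exact ⟨A₁, fun φ₁ φ₂ => h φ₁ φ₂⟩

end Arch

/-! ### §3 Assembly: the stripped pair `(g₁, M₁) ∈ Mp_ψ(W₁)ᶜᵒⁿᵗ` -/

section Strip

variable {ι₁ ι₂ : Type} [Fintype ι₁] [Fintype ι₂] [DecidableEq ι₁] [DecidableEq ι₂]
variable {T₁ : Matrix ι₁ ι₁ (AdeleRing (𝓞 F) F)} {T₂ : Matrix ι₂ ι₂ (AdeleRing (𝓞 F) F)}

omit [DecidableEq ι₁] [DecidableEq ι₂] in
/-- **`⊠ Φ₂`-cancellation**: `Ψ ⊠ Φ₂ = Ψ' ⊠ Φ₂` with `Φ₂ ≠ 0` forces `Ψ = Ψ'`. [folklore] -/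
private theorem tensorToSum_left_cancel {Ψ Ψ' : piSchwartzBruhat F ι₁} {Φ₂ : piSchwartzBruhat F ι₂} (hΦ₂ : Φ₂ ≠ 0)
    (h : tensorToSum F ι₁ ι₂ Ψ Φ₂ = tensorToSum F ι₁ ι₂ Ψ' Φ₂) : Ψ = Ψ' := by
  obtain ⟨x₂, hx₂⟩ : ∃ x₂, (Φ₂ : (ι₂ → AdeleRing (𝓞 F) F) → ℂ) x₂ ≠ 0 := by
    by_contra hcon
    exact hΦ₂ (Subtype.ext (funext fun x => not_not.1 fun hx => hcon ⟨x, hx⟩))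
  apply Subtype.ext
  funext x₁
  have h1 := congrArg (fun Ξ : piSchwartzBruhat F (ι₁ ⊕ ι₂) => (Ξ : (ι₁ ⊕ ι₂ → AdeleRing (𝓞 F) F) → ℂ) (Sum.elim x₁ x₂)) h
  simp only [coe_tensorToSum, boxTensor_elim] at h1
  exact mul_right_cancel₀ hx₂ h1

omit [DecidableEq ι₁] [DecidableEq ι₂] in
/-- A nonzero adelic Schwartz–Bruhat function on `𝔸_F^{ι}` (value `1` at `0`). [folklore] -/
private theorem exists_piSchwartzBruhat_ne_zero (ι : Type) [Fintype ι] : ∃ Φ : piSchwartzBruhat F ι, Φ ≠ 0 := by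
  obtain ⟨φ₀, hφ₀⟩ := exists_schwartzMap_apply_zero_eq_one (F := F) ι
  refine ⟨piSchwartzBruhatEquiv F ι (φ₀ ⊗ₜ indicatorSB F ι (piLevelIdeal F ι ⊤) (isOpen_piLevelIdeal F ⊤)
    (isCompact_piLevelIdeal F ι ⊤)), fun h => ?_⟩
  have h0 := congrArg (fun Ξ : piSchwartzBruhat F ι => (Ξ : (ι → AdeleRing (𝓞 F) F) → ℂ) 0) h
  have hmem : (0 : ι → FiniteAdeleRing (𝓞 F) F) ∈
      ((piLevelIdeal F ι ⊤ : AddSubgroup (ι → FiniteAdeleRing (𝓞 F) F)) : Set (ι → FiniteAdeleRing (𝓞 F) F)) :=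
    zero_mem _
  have hfin : piFinite F ι (0 : ι → AdeleRing (𝓞 F) F) = 0 := funext fun _ => rfl
  simp only [coe_piSchwartzBruhatEquiv_tmul, ZeroMemClass.coe_zero, Pi.zero_apply, piArch_zero', hfin, hφ₀,
    coe_indicatorSB, Set.indicator_of_mem hmem, one_mul, one_ne_zero] at h0

/-- **`ρ(inlH h₁)(Φ₁ ⊠ Φ₂) = ρ₁(h₁) Φ₁ ⊠ Φ₂`** for EVERY Heisenberg element `h₁` of `W₁` (the Schrödinger operator of
an element of the first summand acts on the first variables only). [cite: Weil1964, Chap. I n° 4 p. 149; Kudla1984, §1] -/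
theorem adelicSchrodinger_inlH_tensorToSum (h₁ : AdelicHeisenberg F ι₁ T₁) (Φ₁ : piSchwartzBruhat F ι₁)
    (Φ₂ : piSchwartzBruhat F ι₂) :
    adelicSchrodinger F (ι₁ ⊕ ι₂) (Matrix.fromBlocks T₁ 0 0 T₂) (inlH T₁ T₂ h₁) (tensorToSum F ι₁ ι₂ Φ₁ Φ₂) =
      tensorToSum F ι₁ ι₂ (adelicSchrodinger F ι₁ T₁ h₁ Φ₁) Φ₂ := by
  apply Subtype.ext
  funext u
  have hdot : u ⬝ᵥ (Matrix.fromBlocks T₁ 0 0 T₂ *ᵥ Sum.elim h₁.v.2 (0 : ι₂ → AdeleRing (𝓞 F) F)) =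
      (fun i => u (Sum.inl i)) ⬝ᵥ (T₁ *ᵥ h₁.v.2) := by
    rw [fromBlocks_diag_mulVec_sumElim, Matrix.mulVec_zero]
    conv_lhs => rw [← Sum.elim_comp_inl_inr u]
    rw [sumElim_dotProduct_sumElim, dotProduct_zero, add_zero]
    rfl
  have hadd₁ : (fun i => (u + Sum.elim h₁.v.1 (0 : ι₂ → AdeleRing (𝓞 F) F)) (Sum.inl i)) =
      (fun i => u (Sum.inl i)) + h₁.v.1 := by
    funext i; simp
  have hadd₂ : (fun j => (u + Sum.elim h₁.v.1 (0 : ι₂ → AdeleRing (𝓞 F) F)) (Sum.inr j)) = fun j => u (Sum.inr j) := by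
    funext j; simp
  rw [adelicSchrodinger_apply, coe_tensorToSum, coe_tensorToSum, inlH_t, inlH_v, boxTensor_apply, boxTensor_apply,
    adelicSchrodinger_apply, hdot, hadd₁, hadd₂, mul_assoc]

variable (hT₁ : IsUnit T₁) (hT₂ : IsUnit T₂)

include hT₁ hT₂ in
/-- **The stripped operator, as a tensor `A₁ ⊗ B₁`.** For `(G, M) ∈ Mp_ψ(W₁ ⊕ W₂)ᶜᵒⁿᵗ` over `G = g₁ ⊕ 1` there are a
continuous linear `A₁` of `𝓢((F ⊗ ℝ)^{ι₁})` and a linear `B₁` of `𝒮((𝔸_F^∞)^{ι₁})` with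
`M (Φ₁ ⊠ Φ₂) = (A₁ ⊗ B₁) Φ₁ ⊠ Φ₂` for all `Φ₁, Φ₂`. [cite: Weil1964, Chap. III n° 37–38 pp. 188–190;
MoeglinVignerasWaldspurger1987, Chap. 2 II.1 Rem. (6)] -/
theorem exists_adelicTensorEnd_strip (p : adelicMp F (ι₁ ⊕ ι₂) (Matrix.fromBlocks T₁ 0 0 T₂))
    (hp : p ∈ adelicMpCont F (ι₁ ⊕ ι₂) (Matrix.fromBlocks T₁ 0 0 T₂)) (g₁ : symplecticGroup (polar (adelicForm F ι₁ T₁)))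
    (hG : (p : symplecticGroup (polar (adelicForm F (ι₁ ⊕ ι₂) (Matrix.fromBlocks T₁ 0 0 T₂))) ×
        (piSchwartzBruhat F (ι₁ ⊕ ι₂) ≃ₗ[ℂ] piSchwartzBruhat F (ι₁ ⊕ ι₂))).1 = UnitaryGroup.spSum T₁ T₂ (g₁, 1)) :
    ∃ (A₁ : 𝓢((ι₁ → mixedSpace F), ℂ) →L[ℂ] 𝓢((ι₁ → mixedSpace F), ℂ)) (B₁ : FinSB F ι₁ →ₗ[ℂ] FinSB F ι₁),
      ∀ (Φ₁ : piSchwartzBruhat F ι₁) (Φ₂ : piSchwartzBruhat F ι₂),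
        (p : symplecticGroup (polar (adelicForm F (ι₁ ⊕ ι₂) (Matrix.fromBlocks T₁ 0 0 T₂))) ×
            (piSchwartzBruhat F (ι₁ ⊕ ι₂) ≃ₗ[ℂ] piSchwartzBruhat F (ι₁ ⊕ ι₂))).2 (tensorToSum F ι₁ ι₂ Φ₁ Φ₂) =
          tensorToSum F ι₁ ι₂
            (adelicTensorEnd (A₁ : 𝓢((ι₁ → mixedSpace F), ℂ) →ₗ[ℂ] 𝓢((ι₁ → mixedSpace F), ℂ)) B₁ Φ₁) Φ₂ := by
  have hS₂ := mulVec_surjective_of_isUnit hT₂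
  have hS := mulVec_fromBlocks_surjective (mulVec_surjective_of_isUnit hT₁) hS₂
  -- tensor stripping `M = A ⊗ M_f`
  obtain ⟨Mf, hMf⟩ := exists_finImplementer hS p
  obtain ⟨A, hA, -⟩ := exists_continuousLinearEquiv_of_mem_adelicMpCont hS p hp Mf hMf
  have hAM : ∀ (Φ : 𝓢((ι₁ ⊕ ι₂ → mixedSpace F), ℂ)) (f : FinSB F (ι₁ ⊕ ι₂)),
      (p : symplecticGroup (polar (adelicForm F (ι₁ ⊕ ι₂) (Matrix.fromBlocks T₁ 0 0 T₂))) ×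
          (piSchwartzBruhat F (ι₁ ⊕ ι₂) ≃ₗ[ℂ] piSchwartzBruhat F (ι₁ ⊕ ι₂))).2 (piSchwartzBruhatEquiv F (ι₁ ⊕ ι₂) (Φ ⊗ₜ f)) =
        piSchwartzBruhatEquiv F (ι₁ ⊕ ι₂)
          ((A : 𝓢((ι₁ ⊕ ι₂ → mixedSpace F), ℂ) →ₗ[ℂ] 𝓢((ι₁ ⊕ ι₂ → mixedSpace F), ℂ)) Φ ⊗ₜ
            (Mf : FinSB F (ι₁ ⊕ ι₂) →ₗ[ℂ] FinSB F (ι₁ ⊕ ι₂)) f) := fun Φ f => by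
    rw [← LinearEquiv.coe_coe, hA, adelicTensorEnd_apply_tmul]
  rw [hG] at hMf
  -- the finite factor `M_f = B₁ ⊠ 1`
  obtain ⟨B₁, hB₁⟩ := exists_finStrip hS₂ hMf
  -- the archimedean factor `A = A₁ ⊠ 1`
  have hImp : Implements (adelicSchrodinger F (ι₁ ⊕ ι₂) (Matrix.fromBlocks T₁ 0 0 T₂))
      (ofSymplectic (polar (adelicForm F (ι₁ ⊕ ι₂) (Matrix.fromBlocks T₁ 0 0 T₂))) (UnitaryGroup.spSum T₁ T₂ (g₁, 1)))
      (p : symplecticGroup (polar (adelicForm F (ι₁ ⊕ ι₂) (Matrix.fromBlocks T₁ 0 0 T₂))) ×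
        (piSchwartzBruhat F (ι₁ ⊕ ι₂) ≃ₗ[ℂ] piSchwartzBruhat F (ι₁ ⊕ ι₂))).2 := by
    have h := (mem_MpPsi _ _).1 p.2
    rwa [hG] at h
  have hf₀ : (Mf : FinSB F (ι₁ ⊕ ι₂) →ₗ[ℂ] FinSB F (ι₁ ⊕ ι₂))
      (indicatorSB F (ι₁ ⊕ ι₂) (piLevelIdeal F (ι₁ ⊕ ι₂) ⊤) (isOpen_piLevelIdeal F ⊤)
        (isCompact_piLevelIdeal F (ι₁ ⊕ ι₂) ⊤)) ≠ 0 := by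
    rw [LinearEquiv.coe_coe]
    exact Mf.map_ne_zero_iff.2 indicatorSB_top_ne_zero
  obtain ⟨A₁, hA₁⟩ := exists_archStrip (NumberField.mixedEmbedding.stdBasis F) T₁ T₂
    (isUnit_archMat_of_isUnit (T := T₂) hT₂) (UnitaryGroup.spSum T₁ T₂ (g₁, 1))
    g₁ (fun x₁ y₁ x₂ y₂ => spSum_apply_elim g₁ 1 x₁ y₁ x₂ y₂) _ hImp
    (A : 𝓢((ι₁ ⊕ ι₂ → mixedSpace F), ℂ) →ₗ[ℂ] 𝓢((ι₁ ⊕ ι₂ → mixedSpace F), ℂ))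
    (Mf : FinSB F (ι₁ ⊕ ι₂) →ₗ[ℂ] FinSB F (ι₁ ⊕ ι₂)) hAM hf₀ A.continuous
  -- assembly with both scalars `1`
  refine ⟨A₁, B₁, fun Φ₁ Φ₂ => ?_⟩
  have hinf : ∀ (φ₁ : 𝓢((ι₁ → mixedSpace F), ℂ)) (φ₂ : 𝓢((ι₂ → mixedSpace F), ℂ)),
      (A : 𝓢((ι₁ ⊕ ι₂ → mixedSpace F), ℂ) →ₗ[ℂ] 𝓢((ι₁ ⊕ ι₂ → mixedSpace F), ℂ)) (archBoxTensor φ₁ φ₂) =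
        (1 : ℂ) • archBoxTensor ((A₁ : 𝓢((ι₁ → mixedSpace F), ℂ) →ₗ[ℂ] 𝓢((ι₁ → mixedSpace F), ℂ)) φ₁)
          ((LinearMap.id : 𝓢((ι₂ → mixedSpace F), ℂ) →ₗ[ℂ] 𝓢((ι₂ → mixedSpace F), ℂ)) φ₂) := fun φ₁ φ₂ => by
    rw [one_smul, LinearMap.id_apply]
    exact hA₁ φ₁ φ₂
  have hfin : ∀ (f₁ : FinSB F ι₁) (f₂ : FinSB F ι₂),
      (Mf : FinSB F (ι₁ ⊕ ι₂) →ₗ[ℂ] FinSB F (ι₁ ⊕ ι₂)) (finSumEquiv F ι₁ ι₂ (f₁ ⊗ₜ f₂)) =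
        (1 : ℂ) • finSumEquiv F ι₁ ι₂ (B₁ f₁ ⊗ₜ (LinearMap.id : FinSB F ι₂ →ₗ[ℂ] FinSB F ι₂) f₂) := fun f₁ f₂ => by
    rw [one_smul, LinearMap.id_apply, LinearEquiv.coe_coe]
    exact hB₁ f₁ f₂
  rw [← LinearEquiv.coe_coe, hA, adelicTensorEnd_tensorToSum_eq_smul hinf hfin, one_mul, one_smul, adelicTensorEnd_id,
    LinearMap.id_apply]

include hT₁ hT₂ in
/-- **SUM-STRIPPING THEOREM.** Let `T₁, T₂` be invertible and `(G, M) ∈ Mp_ψ(W₁ ⊕ W₂)ᶜᵒⁿᵗ` with `G = g₁ ⊕ 1`. Then there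
is `(g₁, M₁) ∈ Mp_ψ(W₁)ᶜᵒⁿᵗ` — an LF-continuous implementer of `g₁` on `𝒮(𝔸_F^{ι₁})` — with `M (Φ₁ ⊠ Φ₂) = M₁ Φ₁ ⊠ Φ₂`
for all `Φ₁ ∈ 𝒮(𝔸_F^{ι₁})`, `Φ₂ ∈ 𝒮(𝔸_F^{ι₂})`: the restriction of Weil's metaplectic representation of `W₁ ⊕ W₂` to the
first summand is `𝐫₁ ⊠ 1`. [cite: Weil1964, Chap. III n° 37–38 pp. 188–190; MoeglinVignerasWaldspurger1987, Chap. 2 II.1 Rem. (6);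
Kudla1984, §1] -/
theorem exists_strip_of_fst_eq_spSum_one (p : adelicMp F (ι₁ ⊕ ι₂) (Matrix.fromBlocks T₁ 0 0 T₂))
    (hp : p ∈ adelicMpCont F (ι₁ ⊕ ι₂) (Matrix.fromBlocks T₁ 0 0 T₂)) (g₁ : symplecticGroup (polar (adelicForm F ι₁ T₁)))
    (hG : (p : symplecticGroup (polar (adelicForm F (ι₁ ⊕ ι₂) (Matrix.fromBlocks T₁ 0 0 T₂))) ×
        (piSchwartzBruhat F (ι₁ ⊕ ι₂) ≃ₗ[ℂ] piSchwartzBruhat F (ι₁ ⊕ ι₂))).1 = UnitaryGroup.spSum T₁ T₂ (g₁, 1)) :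
    ∃ p₁ : adelicMp F ι₁ T₁, p₁ ∈ adelicMpCont F ι₁ T₁ ∧
      (p₁ : symplecticGroup (polar (adelicForm F ι₁ T₁)) × (piSchwartzBruhat F ι₁ ≃ₗ[ℂ] piSchwartzBruhat F ι₁)).1 = g₁ ∧
      ∀ (Φ₁ : piSchwartzBruhat F ι₁) (Φ₂ : piSchwartzBruhat F ι₂),
        (p : symplecticGroup (polar (adelicForm F (ι₁ ⊕ ι₂) (Matrix.fromBlocks T₁ 0 0 T₂))) ×
            (piSchwartzBruhat F (ι₁ ⊕ ι₂) ≃ₗ[ℂ] piSchwartzBruhat F (ι₁ ⊕ ι₂))).2 (tensorToSum F ι₁ ι₂ Φ₁ Φ₂) =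
          tensorToSum F ι₁ ι₂
            ((p₁ : symplecticGroup (polar (adelicForm F ι₁ T₁)) × (piSchwartzBruhat F ι₁ ≃ₗ[ℂ] piSchwartzBruhat F ι₁)).2 Φ₁)
            Φ₂ := by
  -- the stripped operators of `p` and of `p⁻¹`
  obtain ⟨A₁, B₁, hN⟩ := exists_adelicTensorEnd_strip hT₁ hT₂ p hp g₁ hG
  have hG' : ((p⁻¹ : adelicMp F (ι₁ ⊕ ι₂) (Matrix.fromBlocks T₁ 0 0 T₂)) :
      symplecticGroup (polar (adelicForm F (ι₁ ⊕ ι₂) (Matrix.fromBlocks T₁ 0 0 T₂))) ×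
        (piSchwartzBruhat F (ι₁ ⊕ ι₂) ≃ₗ[ℂ] piSchwartzBruhat F (ι₁ ⊕ ι₂))).1 = UnitaryGroup.spSum T₁ T₂ (g₁⁻¹, 1) := by
    have h1 : ((g₁⁻¹, 1) : symplecticGroup (polar (adelicForm F ι₁ T₁)) × symplecticGroup (polar (adelicForm F ι₂ T₂))) =
        (g₁, 1)⁻¹ := by
      rw [Prod.inv_mk, inv_one]
    rw [h1, map_inv, ← hG]
    rfl
  obtain ⟨A₁', B₁', hN'⟩ := exists_adelicTensorEnd_strip hT₁ hT₂ p⁻¹ (inv_mem hp) g₁⁻¹ hG'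
  let N : piSchwartzBruhat F ι₁ →ₗ[ℂ] piSchwartzBruhat F ι₁ :=
    adelicTensorEnd (A₁ : 𝓢((ι₁ → mixedSpace F), ℂ) →ₗ[ℂ] 𝓢((ι₁ → mixedSpace F), ℂ)) B₁
  let N' : piSchwartzBruhat F ι₁ →ₗ[ℂ] piSchwartzBruhat F ι₁ :=
    adelicTensorEnd (A₁' : 𝓢((ι₁ → mixedSpace F), ℂ) →ₗ[ℂ] 𝓢((ι₁ → mixedSpace F), ℂ)) B₁'
  have hN₀ : ∀ (Φ₁ : piSchwartzBruhat F ι₁) (Φ₂ : piSchwartzBruhat F ι₂),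
      (p : symplecticGroup (polar (adelicForm F (ι₁ ⊕ ι₂) (Matrix.fromBlocks T₁ 0 0 T₂))) ×
          (piSchwartzBruhat F (ι₁ ⊕ ι₂) ≃ₗ[ℂ] piSchwartzBruhat F (ι₁ ⊕ ι₂))).2 (tensorToSum F ι₁ ι₂ Φ₁ Φ₂) =
        tensorToSum F ι₁ ι₂ (N Φ₁) Φ₂ := hN
  have hN₀' : ∀ (Φ₁ : piSchwartzBruhat F ι₁) (Φ₂ : piSchwartzBruhat F ι₂),
      ((p⁻¹ : adelicMp F (ι₁ ⊕ ι₂) (Matrix.fromBlocks T₁ 0 0 T₂)) :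
          symplecticGroup (polar (adelicForm F (ι₁ ⊕ ι₂) (Matrix.fromBlocks T₁ 0 0 T₂))) ×
            (piSchwartzBruhat F (ι₁ ⊕ ι₂) ≃ₗ[ℂ] piSchwartzBruhat F (ι₁ ⊕ ι₂))).2 (tensorToSum F ι₁ ι₂ Φ₁ Φ₂) =
        tensorToSum F ι₁ ι₂ (N' Φ₁) Φ₂ := hN'
  obtain ⟨Φ₂, hΦ₂⟩ := exists_piSchwartzBruhat_ne_zero (F := F) ι₂
  -- `M⁻¹ M = 1` and `M M⁻¹ = 1` strip to `N' N = 1`, `N N' = 1`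
  have h₁ : N' ∘ₗ N = LinearMap.id := by
    refine LinearMap.ext fun Φ₁ => tensorToSum_left_cancel hΦ₂ ?_
    rw [LinearMap.comp_apply, LinearMap.id_apply, ← hN₀', ← hN₀, ← LinearEquiv.mul_apply, ← Prod.snd_mul,
      ← Subgroup.coe_mul, inv_mul_cancel, OneMemClass.coe_one, Prod.snd_one, LinearEquiv.coe_one, id_eq]
  have h₂ : N ∘ₗ N' = LinearMap.id := by
    refine LinearMap.ext fun Φ₁ => tensorToSum_left_cancel hΦ₂ ?_
    rw [LinearMap.comp_apply, LinearMap.id_apply, ← hN₀, ← hN₀', ← LinearEquiv.mul_apply, ← Prod.snd_mul,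
      ← Subgroup.coe_mul, mul_inv_cancel, OneMemClass.coe_one, Prod.snd_one, LinearEquiv.coe_one, id_eq]
  let M₁ : piSchwartzBruhat F ι₁ ≃ₗ[ℂ] piSchwartzBruhat F ι₁ := LinearEquiv.ofLinear N N' h₂ h₁
  -- `(g₁, M₁)` implements `g₁` on ALL of `H(W₁)(𝔸)`
  have hImp : Implements (adelicSchrodinger F (ι₁ ⊕ ι₂) (Matrix.fromBlocks T₁ 0 0 T₂))
      (ofSymplectic (polar (adelicForm F (ι₁ ⊕ ι₂) (Matrix.fromBlocks T₁ 0 0 T₂))) (UnitaryGroup.spSum T₁ T₂ (g₁, 1)))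
      (p : symplecticGroup (polar (adelicForm F (ι₁ ⊕ ι₂) (Matrix.fromBlocks T₁ 0 0 T₂))) ×
        (piSchwartzBruhat F (ι₁ ⊕ ι₂) ≃ₗ[ℂ] piSchwartzBruhat F (ι₁ ⊕ ι₂))).2 := by
    have h := (mem_MpPsi _ _).1 p.2
    rwa [hG] at h
  have hmem : ((g₁, M₁) : symplecticGroup (polar (adelicForm F ι₁ T₁)) ×
      (piSchwartzBruhat F ι₁ ≃ₗ[ℂ] piSchwartzBruhat F ι₁)) ∈ adelicMp F ι₁ T₁ := by
    rw [mem_MpPsi]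
    intro h₁ Φ₁
    refine tensorToSum_left_cancel hΦ₂ ?_
    change tensorToSum F ι₁ ι₂ (N (adelicSchrodinger F ι₁ T₁ h₁ Φ₁)) Φ₂ =
      tensorToSum F ι₁ ι₂ (adelicSchrodinger F ι₁ T₁ ((ofSymplectic (polar (adelicForm F ι₁ T₁)) g₁).act h₁) (N Φ₁)) Φ₂
    rw [← hN₀, ← adelicSchrodinger_inlH_tensorToSum, hImp, act_spSum_inlH, hN₀, adelicSchrodinger_inlH_tensorToSum]
  refine ⟨⟨(g₁, M₁), hmem⟩, ?_, rfl, fun Φ₁ Φ₂' => hN₀ Φ₁ Φ₂'⟩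
  -- LF-continuity of `M₁ = A₁ ⊗ B₁` and `M₁⁻¹ = A₁' ⊗ B₁'`
  exact mem_adelicMpCont_of_tensor _ A₁ A₁' B₁ B₁' (fun _ => rfl) (fun _ => rfl)

omit [DecidableEq ι₁] [DecidableEq ι₂] in
/-- **Uniqueness of the stripped operator**: `M₁` is determined by `M (Φ₁ ⊠ Φ₂) = M₁ Φ₁ ⊠ Φ₂` (one `Φ₂ ≠ 0`
suffices). [cite: MoeglinVignerasWaldspurger1987, Chap. 2 II.1 Rem. (6)] -/
theorem strip_unique {M₁ M₁' : piSchwartzBruhat F ι₁ →ₗ[ℂ] piSchwartzBruhat F ι₁} {Φ₂ : piSchwartzBruhat F ι₂}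
    (hΦ₂ : Φ₂ ≠ 0)
    (h : ∀ Φ₁ : piSchwartzBruhat F ι₁, tensorToSum F ι₁ ι₂ (M₁ Φ₁) Φ₂ = tensorToSum F ι₁ ι₂ (M₁' Φ₁) Φ₂) :
    M₁ = M₁' :=
  LinearMap.ext fun Φ₁ => tensorToSum_left_cancel hΦ₂ (h Φ₁)

end Strip

end Literature.NumberTheory.Weil1964

end
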